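import Summits.CriticalPhenomena.PercolationContinuityZ3.Theorems.Transplant.SkelConcFaceInnerRun
import Summits.CriticalPhenomena.PercolationContinuityZ3.Theorems.Transplant.SkelConcFaceStep
import Summits.CriticalPhenomena.PercolationContinuityZ3.Theorems.Transplant.SkelWinChainTAR
import Summits.CriticalPhenomena.PercolationContinuityZ3.Theorems.Transplant.SkelConcRoot
import HarnessLib

/-!
# L6 (F) — the INNER ROUTE of a face-step contact in WINDOW form (generic re-typing of `KNCellsBoxProdZ2InnerRoute` and of the containment
# half of `BoxProdZ2ConcFaceRouteGeom`, SHEAR-SCOPE §3.9 Layer 6 (F)): the rooted straight-run data `Skel.innerWAD : Skel.WinAdvData V` of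
# KN's elongated route (Lemma 11) in the window graph `Skel.winGraph G o L_A` about its SOURCE `o` (a vertex of the contact's wired prism;
# stmt-g7's convention "window centre = source"), the route world `Skel.innerQt = Φ.Win o (innerQtPl …) L_A`, and the containments the
# face residue owes: regions inside the face-step window `Win w₀ (farAS x du j) R`, far face inside the target SPAN `M_{a'}(x + du)`, regions
# above the kit cube, the transfer `innerRoute_lt`

builds on p205010 (kernel theorem, internal audit signed; external expert review pending) — nothing in this file uses p205010.
Lane `prim-bschramm`, typed by the `prim-hp-8` lineage (gen 24); helper file (`--supports stmt-CriticalPhenomena-4575 --as helper`).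
NEW FILE over `SkelConcFaceInnerRun` (planar, hp-8 g24), `SkelWinChainTAR` (stmt-g7: `WinAdvData`, `stepDR`, `lt_real_of_advRChain`),
p2's planar `KNCellsBoxProdZ2InnerRun` (`InnerRunOK`, `innerCtr`, `innerρ`) and p2-g4's `SkelConcRoot` (only for `PCells.exists_adj_of_mem_M`).

Port remarks.  (i) The product's inner tube `B_X(c, L_A) ×ˢ ·` about the cube centre `c` becomes the window `Φ.Win o · L_A` about the
source `o` (the consumer takes `L_A ≥` the prism radius so that the whole wired prism and the cube centre lie in `B_G(o, L_A)`).  (ii) The far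
face must land in the SPAN `M_{a'}(x + du) = VWin w₀ (C.M (x+du)) rM`, so deepness is stated with ONE UNIT OF SLACK — `B_G(o, L_A) ⊆ B_G(w₀, R₁')`
with `R₁' + 1 ≤ rM` — and the step device (`mem_VWin_of_zdAdj`, self-adjacency of `C.M`) puts the window vertices into the span.
* §1 `innerWAD`, `innerWAD_advOK`, `innerWAD_stepDR`, `innerWAD_Rim_subset`; the route world `innerQtPl` (planar, verbatim) / `innerQt`;
* §2 containments: `stepDR_subset_innerQt`, `Win_shift_box_subset_innerQt`, `mem_graphBall_of_mem_innerQt`, `mem_innerQt_of_φ_mem`,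
  **`innerQtPl_subset_farAS`**, **`innerQt_subset_Win_farAS`**, `sub_mem_box_of_mem_innerQt` (planar diameter `50 r`),
  **`innerWAD_stepDR_subset_Win_farAS`**, **`innerWAD_coreT_subset_M`** (far face in the target span), `innerWAD_coreT_disjoint`;
* §3 levels: `innerWAD_level_subset` (`j ≤ Rlev + 1`), `innerWAD_wide`; §4 signed levels: `lev_ge_of_mem_aregionR`, `lev_le_of_mem_shift_box`,
  `disjoint_Win_shift_box_stepDR`, `not_mem_stepDR_of_lev_lt`, `coreT_last_subset_stepDR`; §5 **`innerRoute_lt`**.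
[cite: KozmaNitzan2024, §4 Lemma 10 Step IV (pp. 19–21), Lemma 11 (pp. 22–23: Ω, the slabs, the first cube), p. 30 (Step III)]
-/

noncomputable section

open MeasureTheory ProbabilityTheory
open scoped ENNReal Classical

namespace Summit.CriticalPhenomena.PercolationContinuityZ3.Theorems

namespace Transplant

namespace Skel

open Literature.Probability.Percolation Literature.Probability.LatticeModels SimpleGraph KNLevels KNCells ChainPlanar
open Literature.Probability.Percolation.KozmaNitzan
open Literature.Probability.Percolation.KozmaNitzan.Cells (oth oth_ne eq_oth_of_ne sgOf sgOf_sign stepVec_apply_fst stepVec_apply_oth)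
open Literature.Barriers.CriticalPhenomena (graphBall graphBall_finite mem_graphBall_self graphBall_mono)
open BoxProdZ2 (ConcRadiiG InnerRunOK innerCtr innerρ innerCtr_fst innerCtr_oth sg_mul_sub_add innerRun_advOK innerRun_last_subset_M)
open PlanarSkeletonConc

variable {V : Type} {G : SimpleGraph V} [G.LocallyFinite] (Φ : PlanarSkeletonConc G)

/-! ## §1 The rooted straight-run data of the inner route and its route world -/

/-- **The inner straight run of a face-step contact, window form**: window depth `L_A` about the source `o`, start row (`q = 0`) of
half-width `q'` at signed level `ca` / transverse offset `cb` about `C.cen x`, advance `s₁`, `nA` steps, rim parts = the region vertices deeper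
than `L_A − L'_A` from `o`, support `Sfin`. [cite: KozmaNitzan2024, §4 Lemma 11 (p. 22), p. 30] -/
def innerWAD (C : PCells) (x : Site 2) (du : MDir) (o : V) (L_A L'_A : ℕ) (ca cb q' s₁ : ℤ) (R' ℓ₀ nA Rlev N j₀ j₁ : ℕ)
    (Sfin : Finset V) : WinAdvData V where
  Rπ := L_A
  q := 0
  q' := q'
  s₁ := s₁
  ρ := innerρ q' s₁ R' nA
  R' := R'
  ℓ₀ := ℓ₀
  nA := nA
  ax := du.1
  sg := sgOf du
  c := innerCtr C x du ca cb
  Rlev := Rlev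
  N := N
  j₀ := j₀
  j₁ := j₁
  root := o
  Sfin := Sfin
  Rim := fun k => (Φ.Win o (Adv.regionR 0 s₁ (innerρ q' s₁ R' nA) R' du.1 (sgOf du) (innerCtr C x du ca cb) k) L_A).filter
    fun v => v ∉ graphBall G o (L_A - L'_A)

omit Φ in
/-- **The planar route world of a contact**: the first-hop square `v + Λ_{ℓ₁}` and the rooted regions `regionR k`, `k ≤ nA` (verbatim).
[cite: KozmaNitzan2024, §4 Lemma 11 (p. 22: Ω)] -/
def innerQtPl (C : PCells) (x : Site 2) (du : MDir) (s₁ : ℤ) (R' nA : ℕ) (ca cb q' : ℤ) (v : Site 2) (ℓ₁ : ℕ) : Finset (Site 2) :=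
  (box 2 ℓ₁).image (fun t => t + v) ∪
    (Finset.range (nA + 1)).biUnion fun k => Adv.regionR 0 s₁ (innerρ q' s₁ R' nA) R' du.1 (sgOf du) (innerCtr C x du ca cb) k

/-- **The route world of a contact**: the window of depth `L_A` about the source `o` over the planar route world.
[cite: KozmaNitzan2024, §4 Lemma 11 (p. 22: Ω)] -/
def innerQt (C : PCells) (x : Site 2) (du : MDir) (o : V) (L_A : ℕ) (s₁ : ℤ) (R' nA : ℕ) (ca cb q' : ℤ) (v : Site 2) (ℓ₁ : ℕ) :
    Finset V :=
  Φ.Win o (innerQtPl C x du s₁ R' nA ca cb q' v ℓ₁) L_A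

section Geom

variable {C : PCells} {x : Site 2} {du : MDir} {o : V} {L_A L'_A : ℕ} {ca cb q' s₁ : ℤ} {R' ℓ₀ nA Rlev N j₀ j₁ : ℕ} {Sfin : Finset V}
  {v : Site 2}

/-- The sign of the inner run is `±1`. [folklore] -/
theorem innerWAD_sg : (innerWAD Φ C x du o L_A L'_A ca cb q' s₁ R' ℓ₀ nA Rlev N j₀ j₁ Sfin).sg = 1 ∨
    (innerWAD Φ C x du o L_A L'_A ca cb q' s₁ R' ℓ₀ nA Rlev N j₀ j₁ Sfin).sg = -1 := sgOf_sign du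

/-- The inner run is an admissible straight run. [cite: KozmaNitzan2024, §4 Lemma 11] -/
theorem innerWAD_advOK {j : ℕ} (h : InnerRunOK C j s₁ R' ℓ₀ nA ca cb q') :
    let P := innerWAD Φ C x du o L_A L'_A ca cb q' s₁ R' ℓ₀ nA Rlev N j₀ j₁ Sfin
    Adv.AdvOK P.q P.q' P.s₁ P.ρ P.R' P.ℓ₀ P.nA :=
  innerRun_advOK h

/-- The rooted region `k` of the inner run unfolded. [folklore] -/
theorem innerWAD_stepDR (k : ℕ) : (innerWAD Φ C x du o L_A L'_A ca cb q' s₁ R' ℓ₀ nA Rlev N j₀ j₁ Sfin).stepDR Φ k =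
    Φ.Win o (Adv.regionR 0 s₁ (innerρ q' s₁ R' nA) R' du.1 (sgOf du) (innerCtr C x du ca cb) k) L_A := rfl

/-- The rim parts lie in the rooted regions. [folklore] -/
theorem innerWAD_Rim_subset (k : ℕ) : (innerWAD Φ C x du o L_A L'_A ca cb q' s₁ R' ℓ₀ nA Rlev N j₀ j₁ Sfin).Rim k ⊆
    (innerWAD Φ C x du o L_A L'_A ca cb q' s₁ R' ℓ₀ nA Rlev N j₀ j₁ Sfin).stepDR Φ k :=
  Finset.filter_subset _ _

/-! ## §2 Containments -/

/-- **The rooted regions `k ≤ nA` lie in the route world.** [folklore] -/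
theorem stepDR_subset_innerQt {k : ℕ} (hk : k ≤ nA) (v : Site 2) (ℓ₁ : ℕ) :
    (innerWAD Φ C x du o L_A L'_A ca cb q' s₁ R' ℓ₀ nA Rlev N j₀ j₁ Sfin).stepDR Φ k ⊆ innerQt Φ C x du o L_A s₁ R' nA ca cb q' v ℓ₁ := by
  rw [innerWAD_stepDR, innerQt]
  refine Φ.Win_mono (fun y hy => ?_) le_rfl
  rw [innerQtPl]
  exact Finset.mem_union_right _ (Finset.mem_biUnion.2 ⟨k, Finset.mem_range.2 (Nat.lt_succ_of_le hk), hy⟩)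

/-- **The window over the first-hop square lies in the route world.** [folklore] -/
theorem Win_shift_box_subset_innerQt (ℓ₁ : ℕ) :
    Φ.Win o ((box 2 ℓ₁).image (fun t => t + v)) L_A ⊆ innerQt Φ C x du o L_A s₁ R' nA ca cb q' v ℓ₁ := by
  rw [innerQt, innerQtPl]; exact Φ.Win_mono Finset.subset_union_left le_rfl

/-- The route world lies in the ball of the inner window graph. [folklore] -/
theorem mem_graphBall_of_mem_innerQt {ℓ₁ : ℕ} {u : V} (hu : u ∈ innerQt Φ C x du o L_A s₁ R' nA ca cb q' v ℓ₁) :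
    u ∈ graphBall G o L_A :=
  (Φ.mem_Win.1 hu).1

/-- **A vertex within depth `L_A` of the source whose footprint lies in the first-hop square lies in the route world** (e.g. the source and
the whole wired prism). [folklore] -/
theorem mem_innerQt_of_φ_mem {ℓ₁ : ℕ} {u : V} (hu : u ∈ graphBall G o L_A) (hφ : Φ.φ u ∈ (box 2 ℓ₁).image (fun t => t + v)) :
    u ∈ innerQt Φ C x du o L_A s₁ R' nA ca cb q' v ℓ₁ :=
  Win_shift_box_subset_innerQt Φ ℓ₁ (Φ.mem_Win.2 ⟨hu, hφ⟩)

omit [G.LocallyFinite] Φ in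
/-- **The planar route world lies in `farAS x du j`**: the regions by `innerRun_regionR_subset_farAS`, the first-hop square when its levels
`[lv − ℓ₁, lv + ℓ₁]` lie in `[5r + 10 s j + 2, 25 r − 1]` and its transverse extent within `5 r − 2` (`lv` the signed level of `v`).
[cite: KozmaNitzan2024, §4 Lemma 11 (p. 22: Ω), p. 30] -/
theorem innerQtPl_subset_farAS {j : ℕ} (h : InnerRunOK C j s₁ R' ℓ₀ nA ca cb q')
    (hlo₂ : 5 * (C.r : ℤ) + 10 * C.s * j + 2 + s₁ + 2 * R' ≤ ca) (htr₂ : |cb| + q' + 2 * s₁ + ((nA : ℤ) + 3) * R' ≤ 5 * (C.r : ℤ) - 2)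
    {ℓ₁ : ℕ} (h1 : 5 * (C.r : ℤ) + 10 * C.s * j + 2 ≤ C.lev du x v - ℓ₁) (h2 : C.lev du x v + ℓ₁ ≤ 25 * (C.r : ℤ) - 1)
    (h3 : C.cen x (oth du.1) - (5 * (C.r : ℤ) - 2) ≤ v (oth du.1) - ℓ₁) (h4 : v (oth du.1) + ℓ₁ ≤ C.cen x (oth du.1) + (5 * (C.r : ℤ) - 2)) :
    innerQtPl C x du s₁ R' nA ca cb q' v ℓ₁ ⊆ C.farAS x du j := by
  rw [innerQtPl]
  refine Finset.union_subset ?_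
    (Finset.biUnion_subset.2 fun k hk => C.innerRun_regionR_subset_farAS h hlo₂ htr₂ (Nat.le_of_lt_succ (Finset.mem_range.1 hk)))
  rw [PCells.farAS]
  unfold PCells.lev at h1 h2
  refine shift_box_subset_sBox (sgOf_sign du) (by linarith) (by linarith) fun i hi => ?_
  rw [eq_oth_of_ne hi]; exact ⟨by linarith, by linarith⟩

/-- **The route world lies in the face-step window `Win w₀ (farAS x du j) R`** when its ball lies in `B_G(w₀, R)`. [folklore] -/
theorem innerQt_subset_Win_farAS {w₀ : V} {R : ℕ} (hball : graphBall G o L_A ⊆ graphBall G w₀ R) {j : ℕ} (h : InnerRunOK C j s₁ R' ℓ₀ nA ca cb q')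
    (hlo₂ : 5 * (C.r : ℤ) + 10 * C.s * j + 2 + s₁ + 2 * R' ≤ ca) (htr₂ : |cb| + q' + 2 * s₁ + ((nA : ℤ) + 3) * R' ≤ 5 * (C.r : ℤ) - 2)
    {ℓ₁ : ℕ} (h1 : 5 * (C.r : ℤ) + 10 * C.s * j + 2 ≤ C.lev du x v - ℓ₁) (h2 : C.lev du x v + ℓ₁ ≤ 25 * (C.r : ℤ) - 1)
    (h3 : C.cen x (oth du.1) - (5 * (C.r : ℤ) - 2) ≤ v (oth du.1) - ℓ₁) (h4 : v (oth du.1) + ℓ₁ ≤ C.cen x (oth du.1) + (5 * (C.r : ℤ) - 2)) :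
    innerQt Φ C x du o L_A s₁ R' nA ca cb q' v ℓ₁ ⊆ Φ.Win w₀ (C.farAS x du j) R := by
  intro u hu
  obtain ⟨hu1, hu2⟩ := Φ.mem_Win.1 hu
  exact Φ.mem_Win.2 ⟨hball hu1, innerQtPl_subset_farAS h hlo₂ htr₂ h1 h2 h3 h4 hu2⟩

/-- Points of the route world differ by at most `50 r` in every planar coordinate (once the planar route world lies in `farAS`). [folklore] -/
theorem sub_mem_box_of_mem_innerQt {j : ℕ} {ℓ₁ : ℕ} (hQ : innerQtPl C x du s₁ R' nA ca cb q' v ℓ₁ ⊆ C.farAS x du j) {u u' : V}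
    (hu : u ∈ innerQt Φ C x du o L_A s₁ R' nA ca cb q' v ℓ₁) (hu' : u' ∈ innerQt Φ C x du o L_A s₁ R' nA ca cb q' v ℓ₁) :
    Φ.φ u - Φ.φ u' ∈ box 2 (50 * C.r) :=
  C.sub_mem_box_of_mem_EfarN (C.farAS_subset_EfarN x du j (hQ (Φ.mem_Win.1 hu).2)) (C.farAS_subset_EfarN x du j (hQ (Φ.mem_Win.1 hu').2))

/-- **The rooted regions lie in the face-step window `Win w₀ (farAS x du j) R`** (`k ≤ nA`; ball of the inner window inside `B_G(w₀, R)`).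
[cite: KozmaNitzan2024, §4 p. 30 (Step III), Lemma 11 (p. 22: Ω)] -/
theorem innerWAD_stepDR_subset_Win_farAS {w₀ : V} {R : ℕ} (hball : graphBall G o L_A ⊆ graphBall G w₀ R) {j : ℕ}
    (h : InnerRunOK C j s₁ R' ℓ₀ nA ca cb q') (hlo₂ : 5 * (C.r : ℤ) + 10 * C.s * j + 2 + s₁ + 2 * R' ≤ ca)
    (htr₂ : |cb| + q' + 2 * s₁ + ((nA : ℤ) + 3) * R' ≤ 5 * (C.r : ℤ) - 2) {k : ℕ} (hk : k ≤ nA) :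
    (innerWAD Φ C x du o L_A L'_A ca cb q' s₁ R' ℓ₀ nA Rlev N j₀ j₁ Sfin).stepDR Φ k ⊆ Φ.Win w₀ (C.farAS x du j) R := by
  rw [innerWAD_stepDR]
  intro u hu
  obtain ⟨hu1, hu2⟩ := Φ.mem_Win.1 hu
  exact Φ.mem_Win.2 ⟨hball hu1, C.innerRun_regionR_subset_farAS h hlo₂ htr₂ hk hu2⟩

/-- **The far face of the inner run lies in the target SPAN `M_{a'}(x + du)`** under deepness with one unit of slack: `B_G(o, L_A) ⊆ B_G(w₀, R₁')`
and `R₁' + 1 ≤ rM_{a'}(x + du)` (the step device puts the window vertices into the span). [cite: KozmaNitzan2024, §4 Lemma 10 Step IV (p. 20), p. 30] -/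
theorem innerWAD_coreT_subset_M [DecidableEq V] {w₀ : V} {Λ : ConcRadiiG} {a' : ℕ} {R₁' : ℕ} (hball : graphBall G o L_A ⊆ graphBall G w₀ R₁')
    (hR : R₁' + 1 ≤ Λ.rM a' (x + stepVec du)) {j : ℕ} (h : InnerRunOK C j s₁ R' ℓ₀ nA ca cb q') :
    (innerWAD Φ C x du o L_A L'_A ca cb q' s₁ R' ℓ₀ nA Rlev N j₀ j₁ Sfin).coreT Φ nA ⊆ (cellGeomSG Φ C w₀ Λ).M a' (x + stepVec du) := by
  intro u hu
  change u ∈ Φ.Win o (Adv.core 0 q' s₁ R' du.1 (sgOf du) (innerCtr C x du ca cb) (nA + 1)) L_A at hu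
  obtain ⟨hu1, hu2⟩ := Φ.mem_Win.1 hu
  have hM : Φ.φ u ∈ C.M (x + stepVec du) := innerRun_last_subset_M h hu2
  change u ∈ Φ.VWin w₀ (C.M (x + stepVec du)) (Λ.rM a' (x + stepVec du))
  exact Φ.mem_VWin_of_zdAdj (hball hu1) hR hM (C.exists_adj_of_mem_M _ hM)

/-- **The far face misses the contact's kit cube** as soon as the cube's planar shadow misses `C.M (x + du)`. [folklore] -/
theorem innerWAD_coreT_disjoint [DecidableEq V] {j : ℕ} (h : InnerRunOK C j s₁ R' ℓ₀ nA ca cb q') {Kc : Finset V}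
    (hKc : ∀ z ∈ Kc, Φ.φ z ∉ C.M (x + stepVec du)) :
    Disjoint ((innerWAD Φ C x du o L_A L'_A ca cb q' s₁ R' ℓ₀ nA Rlev N j₀ j₁ Sfin).coreT Φ nA) Kc := by
  rw [Finset.disjoint_left]
  intro z hz hzK
  change z ∈ Φ.Win o (Adv.core 0 q' s₁ R' du.1 (sgOf du) (innerCtr C x du ca cb) (nA + 1)) L_A at hz
  exact hKc z hzK (innerRun_last_subset_M h (Φ.mem_Win.1 hz).2)

/-! ## §3 Levels and widths of the rooted cores -/

/-- **The window levels `j ≤ Rlev + 1` of the rooted step `k ≤ nA` lie in its region** (`Rlev + 1 ≤ R'`). [cite: KozmaNitzan2024, §4 Lemma 10 (p. 17)] -/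
theorem innerWAD_level_subset {j' : ℕ} (h : InnerRunOK C j' s₁ R' ℓ₀ nA ca cb q') (hRl : Rlev + 1 ≤ R') {k : ℕ} (hk : k ≤ nA) {j : ℕ}
    (hj : j ≤ Rlev + 1) :
    let P := innerWAD Φ C x du o L_A L'_A ca cb q' s₁ R' ℓ₀ nA Rlev N j₀ j₁ Sfin
    winLevel Φ o L_A (P.alo k) (P.ahi k) j ⊆ P.stepDR Φ k := by
  intro P
  have h1 : winLevel Φ o L_A (P.alo k) (P.ahi k) j ⊆ winLevel Φ o L_A (P.alo k) (P.ahi k) (P.Rlev + 1) := winLevel_monotone Φ _ _ _ _ hj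
  have h2 := WinAdvData.enclR Φ (P := P) (innerWAD_sg Φ) (innerWAD_advOK Φ h) hRl hk
  exact h1.trans h2

/-- **Every level `j ≥ M + 1` of every rooted core is at least `2M + 2` wide in each coordinate** (the cores are nonempty rows). [folklore] -/
theorem innerWAD_wide {j' : ℕ} (h : InnerRunOK C j' s₁ R' ℓ₀ nA ca cb q') (k : ℕ) {M j : ℕ} (hMj : M + 1 ≤ j) :
    let P := innerWAD Φ C x du o L_A L'_A ca cb q' s₁ R' ℓ₀ nA Rlev N j₀ j₁ Sfin
    ∀ i, (P.alo k - ((j : ℕ) : Site 2)) i + 2 * M + 2 ≤ (P.ahi k + ((j : ℕ) : Site 2)) i := by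
  intro P i
  have hne := Adv.core_nonempty (sgOf_sign du) (innerCtr C x du ca cb) (innerRun_advOK h) k (a := du.1)
  have hle : P.alo k ≤ P.ahi k := Finset.nonempty_Icc.1 hne
  have hk := hle i
  have hMj' : (M : ℤ) + 1 ≤ j := by exact_mod_cast hMj
  simp only [Pi.sub_apply, Pi.add_apply, Pi.natCast_apply]
  linarith

/-! ## §4 Signed levels: the regions lie above the kit cube -/

omit [G.LocallyFinite] Φ in
/-- **Every point of a rooted region `k ≤ nA` has signed level `≥ ca − (s₁ + 2R')`.** [cite: KozmaNitzan2024, §4 Lemma 11 (p. 22: Ω)] -/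
theorem lev_ge_of_mem_aregionR {j : ℕ} (h : InnerRunOK C j s₁ R' ℓ₀ nA ca cb q') {k : ℕ} (hk : k ≤ nA) {y : Site 2}
    (hy : y ∈ Adv.regionR 0 s₁ (innerρ q' s₁ R' nA) R' du.1 (sgOf du) (innerCtr C x du ca cb) k) : ca - (s₁ + 2 * R') ≤ C.lev du x y := by
  have hy' := Adv.regionR_subset_prism (sgOf_sign du) (innerCtr C x du ca cb) (innerRun_advOK h) hk hy
  rw [PCells.mem_psBox_iff] at hy'
  simp only [innerCtr_fst, sg_mul_sub_add, Adv.ρ₀] at hy'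
  unfold PCells.lev
  linarith [hy'.1.1]

omit [G.LocallyFinite] Φ in
/-- **A point of the shifted square `v + Λ_m` has signed level `≤ lev v + m`.** [folklore] -/
theorem lev_le_of_mem_shift_box {m : ℕ} {y : Site 2} (hy : y ∈ (box 2 m).image (fun t => t + v)) : C.lev du x y ≤ C.lev du x v + m := by
  obtain ⟨t, ht, rfl⟩ := Finset.mem_image.1 hy
  rw [mem_box] at ht
  have := ht du.1
  unfold PCells.lev
  simp only [Pi.add_apply]
  rcases sgOf_sign du with hs | hs <;> rw [hs] <;> linarith [this.1, this.2]

/-- **A window over a shifted square `v + Λ_m` misses every rooted region** when `lev v + m < ca − (s₁ + 2R')` (the kit cube below region `0`).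
[folklore] -/
theorem disjoint_Win_shift_box_stepDR [DecidableEq V] {j : ℕ} (h : InnerRunOK C j s₁ R' ℓ₀ nA ca cb q') {k : ℕ} (hk : k ≤ nA) {m : ℕ}
    (hsep : C.lev du x v + m < ca - (s₁ + 2 * R')) (c : V) (L : ℕ) :
    Disjoint (Φ.Win c ((box 2 m).image (fun t => t + v)) L) ((innerWAD Φ C x du o L_A L'_A ca cb q' s₁ R' ℓ₀ nA Rlev N j₀ j₁ Sfin).stepDR Φ k) := by
  rw [innerWAD_stepDR, Finset.disjoint_left]
  intro u hu hu'
  have h1 := lev_le_of_mem_shift_box (C := C) (x := x) (du := du) (Φ.mem_Win.1 hu).2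
  have h2 := lev_ge_of_mem_aregionR h hk (Φ.mem_Win.1 hu').2
  linarith

/-- **Any set whose footprints lie in `φ c' + Λ_m` misses every rooted region** when `lev (φ c') + m < ca − (s₁ + 2R')` (for the kit cube
`Skel.fatSeq c' M ⊆ cyl c' M`). [folklore] -/
theorem disjoint_stepDR_of_sub_mem_box [DecidableEq V] {j : ℕ} (h : InnerRunOK C j s₁ R' ℓ₀ nA ca cb q') {k : ℕ} (hk : k ≤ nA) {m : ℕ}
    {c' : V} (hsep : C.lev du x (Φ.φ c') + m < ca - (s₁ + 2 * R')) {Kc : Finset V} (hKc : ∀ z ∈ Kc, Φ.φ z - Φ.φ c' ∈ box 2 m) :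
    Disjoint Kc ((innerWAD Φ C x du o L_A L'_A ca cb q' s₁ R' ℓ₀ nA Rlev N j₀ j₁ Sfin).stepDR Φ k) := by
  rw [innerWAD_stepDR, Finset.disjoint_left]
  intro u hu hu'
  have hφ : Φ.φ u ∈ (box 2 m).image (fun t => t + Φ.φ c') :=
    Finset.mem_image.2 ⟨Φ.φ u - Φ.φ c', hKc u hu, sub_add_cancel _ _⟩
  have h1 := lev_le_of_mem_shift_box (C := C) (x := x) (du := du) hφ
  have h2 := lev_ge_of_mem_aregionR h hk (Φ.mem_Win.1 hu').2
  linarith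

/-- **A vertex of signed level `< ca − (s₁ + 2R')` is off every rooted region** (the source `o`). [folklore] -/
theorem not_mem_stepDR_of_lev_lt {j : ℕ} (h : InnerRunOK C j s₁ R' ℓ₀ nA ca cb q') {k : ℕ} (hk : k ≤ nA) {u : V}
    (hsep : C.lev du x (Φ.φ u) < ca - (s₁ + 2 * R')) :
    u ∉ (innerWAD Φ C x du o L_A L'_A ca cb q' s₁ R' ℓ₀ nA Rlev N j₀ j₁ Sfin).stepDR Φ k := by
  intro hm
  rw [innerWAD_stepDR] at hm
  have h2 := lev_ge_of_mem_aregionR h hk (Φ.mem_Win.1 hm).2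
  linarith

/-- The last true target lies in the last rooted region. [folklore] -/
theorem coreT_last_subset_stepDR {j : ℕ} (h : InnerRunOK C j s₁ R' ℓ₀ nA ca cb q') :
    (innerWAD Φ C x du o L_A L'_A ca cb q' s₁ R' ℓ₀ nA Rlev N j₀ j₁ Sfin).coreT Φ nA ⊆
      (innerWAD Φ C x du o L_A L'_A ca cb q' s₁ R' ℓ₀ nA Rlev N j₀ j₁ Sfin).stepDR Φ nA :=
  WinAdvData.coreT_subset_stepDR Φ (P := innerWAD Φ C x du o L_A L'_A ca cb q' s₁ R' ℓ₀ nA Rlev N j₀ j₁ Sfin) (innerWAD_sg Φ)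
    (innerWAD_advOK Φ h) le_rfl

end Geom

/-! ## §5 The inner route transferred -/

/-- **THE INNER ROUTE TRANSFERRED** (`WinAdvData.lt_real_of_advRChain` for `innerWAD`): with the planar admissibility `InnerRunOK`, nonempty true
targets, the per-step facts of the law `W'` on the rooted regions, the kit clauses, the rim excess `≤ η ≤ δ/2`, the chain property of length
`nA + 1` at `(δ ↦ ε'')` in the window graph about the source, the first hop into `B₀ ⊆ X^{(0)}_0` and the domination of `P_{W'}(o ↔ far face)`
by `μA`, we get `1 − ε'' < μA`. [cite: KozmaNitzan2024, §4 Lemma 11 (pp. 22–23), Lemma 12 (pp. 23–25), p. 20 (Step IV)] -/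
theorem innerRoute_lt [DecidableEq V] [Countable V] {C : PCells} {x : Site 2} {du : MDir} {o : V} {L_A L'_A : ℕ} {ca cb q' s₁ : ℤ}
    {R' ℓ₀ nA Rlev N j₀ j₁ : ℕ} {Sfin : Finset V} {j : ℕ} (h : InnerRunOK C j s₁ R' ℓ₀ nA ca cb q') (hRl : Rlev + 1 ≤ R') (hj : j₁ ≤ Rlev)
    (hTne : ∀ k ≤ nA, ((innerWAD Φ C x du o L_A L'_A ca cb q' s₁ R' ℓ₀ nA Rlev N j₀ j₁ Sfin).coreT Φ k).Nonempty)
    {p : unitInterval} {W' : Sym2 V → unitInterval} {Ft B₀ : Finset V} {μA : ℝ} {Δ' : ℕ} {δ ε'' η : ℝ}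
    (hchain : ∀ (Wg : Sym2 V → unitInterval) (s : Fin (nA + 1) → TStep (winGraph G o L_A)) (T' : Fin (nA + 1) → Finset V) (η : ℝ),
      (∀ i, (s i).L.o = (s 0).L.o) →
      (∀ i : Fin nA, T' (Fin.castSucc i) ⊆ (s i.succ).L.X 0) →
      (∀ i, T' i ⊆ (s i).T) →
      (∀ i, (s i).KitsAt Wg p Δ' δ) →
      η ≤ δ / 2 →
      (∀ i, (prodBernoulli Wg).real (⋃ t ∈ (s i).T \ T' i, openConn (s 0).L.o t) ≤ η) →
      1 - δ < (prodBernoulli Wg).real (s 0).L.reachB →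
        1 - ε'' < (prodBernoulli Wg).real (⋃ t ∈ T' (Fin.last nA), openConn (s 0).L.o t))
    (hsub : ∀ k ≤ nA, IsSubbox (winGraph G o L_A) W' p ((innerWAD Φ C x du o L_A L'_A ca cb q' s₁ R' ℓ₀ nA Rlev N j₀ j₁ Sfin).stepDR Φ k))
    (hfin : FinSupp W' Sfin)
    (hDS : ∀ k ≤ nA, (innerWAD Φ C x du o L_A L'_A ca cb q' s₁ R' ℓ₀ nA Rlev N j₀ j₁ Sfin).stepDR Φ k ⊆ Sfin)
    (ho : ∀ k ≤ nA, o ∉ (innerWAD Φ C x du o L_A L'_A ca cb q' s₁ R' ℓ₀ nA Rlev N j₀ j₁ Sfin).stepDR Φ k) (hoS : o ∈ Sfin)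
    (hcount : 1 / (1 - (p : ℝ)) ^ (Δ' * N) ≤ δ * ((Finset.Icc j₀ j₁).card : ℝ))
    (hkits : ∀ k ≤ nA, ∀ j' ∈ Finset.Icc j₀ j₁, ∃ (σ : SData V) (Sz : Finset V),
      SHyp (winLData Φ o L_A ((innerWAD Φ C x du o L_A L'_A ca cb q' s₁ R' ℓ₀ nA Rlev N j₀ j₁ Sfin).alo k)
        ((innerWAD Φ C x du o L_A L'_A ca cb q' s₁ R' ℓ₀ nA Rlev N j₀ j₁ Sfin).ahi k) o Sfin) j' σ ∧ σ.N ≤ N ∧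
      (1 - (p : ℝ) ^ σ.sB) ^ σ.k ≤ δ ∧
      Sz ⊆ (winLData Φ o L_A ((innerWAD Φ C x du o L_A L'_A ca cb q' s₁ R' ℓ₀ nA Rlev N j₀ j₁ Sfin).alo k)
        ((innerWAD Φ C x du o L_A L'_A ca cb q' s₁ R' ℓ₀ nA Rlev N j₀ j₁ Sfin).ahi k) o Sfin).X j' ∧
      Sz ⊆ (innerWAD Φ C x du o L_A L'_A ca cb q' s₁ R' ℓ₀ nA Rlev N j₀ j₁ Sfin).stepDR Φ k ∧
      (∀ y ∈ σ.K, ∀ e ∈ σ.seed y, e ∉ wireSet (↑Sz : Set V)) ∧ (∀ y ∈ σ.K, σ.face y ⊆ Sz) ∧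
      (∀ y ∈ σ.K, 1 - 3 * δ ≤ (prodBernoulli W').real {ω | ∃ u ∈ σ.face y,
        1 - δ < (prodBernoulli (pinW W' (wireSet (↑Sz : Set V)) ω)).real
          (⋃ z ∈ (innerWAD Φ C x du o L_A L'_A ca cb q' s₁ R' ℓ₀ nA Rlev N j₀ j₁ Sfin).coreE Φ k,
            openConnIn (↑((innerWAD Φ C x du o L_A L'_A ca cb q' s₁ R' ℓ₀ nA Rlev N j₀ j₁ Sfin).stepDR Φ k) : Set V) u z)}))
    (hη : η ≤ δ / 2)
    (hexc : ∀ k ≤ nA, (prodBernoulli W').real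
      (⋃ z ∈ (innerWAD Φ C x du o L_A L'_A ca cb q' s₁ R' ℓ₀ nA Rlev N j₀ j₁ Sfin).Rim k, openConn o z) ≤ η)
    (hB₀ : B₀ ⊆ Φ.Win o (Adv.core 0 q' s₁ R' du.1 (sgOf du) (innerCtr C x du ca cb) 0) L_A)
    (hsrc : 1 - δ < (prodBernoulli W').real (⋃ z ∈ B₀, openConn o z))
    (hTn : (innerWAD Φ C x du o L_A L'_A ca cb q' s₁ R' ℓ₀ nA Rlev N j₀ j₁ Sfin).coreT Φ nA ⊆ Ft)
    (hdom : (prodBernoulli W').real (⋃ z ∈ Ft, openConn o z) ≤ μA) :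
    1 - ε'' < μA := by
  set P := innerWAD Φ C x du o L_A L'_A ca cb q' s₁ R' ℓ₀ nA Rlev N j₀ j₁ Sfin with hP
  have hsg : P.sg = 1 ∨ P.sg = -1 := sgOf_sign du
  have hOK : Adv.AdvOK P.q P.q' P.s₁ P.ρ P.R' P.ℓ₀ P.nA := innerRun_advOK h
  refine WinAdvData.lt_real_of_advRChain Φ hsg hOK hRl (innerWAD_Rim_subset Φ) hTne hchain hsub hfin hDS ho hoS hj hcount hkits hη hexc ?_
    hsrc hTn hdom
  -- the first-hop box lies in the first level `Win o (core 0) L_A`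
  rw [P.stepL_X_zero Φ hsg]
  exact hB₀

end Skel

end Transplant

end Summit.CriticalPhenomena.PercolationContinuityZ3.Theorems

end
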